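import Summits.QuantumFields.YangMills.Theorems.Y2BridgeKing
import HarnessLib

/-!
# Route `BalabanLadder`, crux `ROT` (stmt-QuantumFields-20042): vocabulary of the rev-2′ rotation leg — torus classes

Route-posited objects (D-0016 Defs file; no `Theses` import, so that a re-typed route item may reference them) for the owner's
ruling of 2026-08-26T17:18:42Z on crux `ROT` (ym-beyond-p2 g20; preview `pub/ym-beyond/p2-g20-files/R85_closes_preview.lean`
a4c2b2513e9cd370, namespace `YMBeyond.P2.R85Preview`), re-homed VERBATIM to the Theorems namespace
`Summit.QuantumFields.YangMills.Theorems.ROT`: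

* `UnboundedClass S` — a class of torus half-sides `S ⊆ ℕ` meeting every demand (`∀ N, ∃ L ∈ S, N ≤ L`);
* `LatticeRotWardOn G r a S` — the rotation-Ward leg `Y2Bridge.LatticeRotWard G r a` VERBATIM, restricted to admissible schemes whose
  torus half-sides all lie in `S` (`LatticeRotWardOn G r a univ ↔ LatticeRotWard G r a`);
* `BridgeOnClass` — the statement of the bridge re-run the ruling authorises (PROVED in `Theorems/BalabanLadderROTBridgeOnClass.lean`):
  from `MomentBounds6 ∧ LowerBounds ∧ GapInUnits` at `(r, a)` and the rotation leg on ANY unbounded class `S`, the Yang–Mills OS data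
  with both gaps along some scheme.

Why (located finding `FINDING-20042-IR-guard.md`, evidence on the item; `Theorems/BalabanLadderROTCommensurability.lean`): King's
two-orientation comparison (CMP 103 (1986) Thm 2.4) needs tori fitted by both lattices (`q ∣ 2L+1` for a Pythagorean modulus `q`;
`unboundedClass_fitted`), while tori of side `3^j` fit no rotated lattice; letting the bridge CHOOSE its tori inside an unbounded
fitted class removes the torus-SIZE transfer (non-fitted → fitted tori) from the infrared input the rotation leg would otherwise consume;
the TILT transfer (axis theory on the straight torus `ℝ⁴/Nℤ⁴` vs on the tilted torus `ℝ⁴/R(Nℤ⁴)`, King II (2.24)–(2.25)) persists on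
every class (caveat (iii′) of ym-beyond-p4 g17, N-ROT-NODE-MEMO v2 §5; acknowledged in FINDING v3).  The candidate
decl `ROT` rev 2′ := `… → LowerBounds → MomentBounds6 → GapInUnits → ∃ S, UnboundedClass S ∧ LatticeRotWardOn G r a S` (owner's text)
is NOT declared here (route items are the gate's); nothing below is asserted.
-/

set_option autoImplicit false

noncomputable section

open scoped SchwartzMap
open MeasureTheory Filter Topology
open Literature.MathematicalPhysics.QuantumFieldTheory Literature.MathematicalPhysics.QuantumLattice
open Literature.MathematicalPhysics.AQFT Literature.Probability.LatticeModels
open Summit.QuantumFields.YangMills.Cruxes.OSLegsFromFemtoAndGap.DlrCollarTransfer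
open Summit.QuantumFields.YangMills.Cruxes.OSLegsAtWeakCouplingC.Sketch
open Summit.QuantumFields.YangMills.Cruxes.OSLegsAtWeakCouplingC.Y2Bridge
open Summit.QuantumFields.YangMills.Theorems.OSLegsFromFemtoAndGap (latticeDist)
open Summit.QuantumFields.YangMills.Theorems.NPointIsotropy.Negative (E4)

namespace Summit.QuantumFields.YangMills.Theorems.ROT

/-! ## §1 Torus classes and the rotation leg on a class -/

/-- **Unbounded torus class**: every demand `N` is met by some half-side `L ∈ S` with `N ≤ L` (verbatim the owner's preview). -/
def UnboundedClass (S : Set ℕ) : Prop := ∀ N : ℕ, ∃ L ∈ S, N ≤ L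

section Binder

variable (G : Type) [Group G] [TopologicalSpace G] [IsTopologicalGroup G] [CompactSpace G]
  [MeasurableSpace G] [BorelSpace G] (r : LatticeRep G) (a : ℝ → ℝ)

/-- **`LatticeRotWardOn S`** — `Y2Bridge.LatticeRotWard G r a` VERBATIM, restricted to the admissible schemes in units `a` whose
torus half-sides all lie in the class `S` (verbatim the owner's preview): along every such scheme there is `r₀ > 0` such that for
`n ≥ 2` and every off-diagonal, compactly supported, separated test function `F` of diameter `< r₀`, the centred `a⁻⁴`-renormalised
lattice `n`-point distribution of the action density annihilates the rotation-generator derivative `D` of `F` in the limit. -/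
def LatticeRotWardOn (S : Set ℕ) : Prop :=
  ∀ (sch : SpeciesScheme (YMSpecies G)), (∀ k, sch.L k ∈ S) → (∀ k, sch.a k = a (sch.β k)) →
    Tendsto sch.β atTop atTop →
    (∀ k, 0 ≤ sch.β k ∧ sch.a k ≤ 1 / 24 ∧ 14 ≤ sch.L k ∧ (sch.a k)⁻¹ * (sch.a k)⁻¹ ≤ sch.L k) →
      ∃ r₀ : ℝ, 0 < r₀ ∧ ∀ (n : ℕ), 2 ≤ n → ∀ (F D : 𝓢((Fin n → E4), ℂ)), IsOffDiagonal F →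
        HasCompactSupport (F : (Fin n → E4) → ℂ) →
        (∃ δ : ℝ, 0 < δ ∧ tsupport (F : (Fin n → E4) → ℂ) ⊆ Separated n δ) →
        tsupport (F : (Fin n → E4) → ℂ) ⊆ SmallDiam n r₀ →
        (∀ x, D x = fderiv ℝ (F : (Fin n → E4) → ℂ) x
          (fun k => (x k 0) • (EuclideanSpace.single 1 1 : E4) - (x k 1) • (EuclideanSpace.single 0 1 : E4))) →
        Tendsto (fun k => latticeDist r.ρ (sch.β k) (sch.L k) (sch.a k) r.curvature.F
          (wilsonTorusMean r.ρ (sch.β k) (sch.L k) r.curvature.F) n D) atTop (𝓝 0)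

end Binder

/-! ## §2 The bridge re-run on a class (statement; proved in `Theorems/BalabanLadderROTBridgeOnClass.lean`) -/

/-- **`BridgeOnClass`** (verbatim the owner's typed target): for every compact simple `G`, every `r`, every positive unit map `a → 0`
carrying `MomentBounds6`, `LowerBounds`, `GapInUnits`, and every unbounded torus class `S` on which the rotation leg holds, there are a
scheme (whose tori the bridge chooses IN `S`) and Yang–Mills OS data along it: non-trivial, non-Gaussian, with the continuum mass gap
and the lattice mass gap at one rate. -/
def BridgeOnClass : Prop :=
  ∀ (G : Type) [Group G] [TopologicalSpace G] [IsTopologicalGroup G] [CompactSpace G],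
    IsCompactSimpleLieGroup G → letI : MeasurableSpace G := borel G; haveI : BorelSpace G := ⟨rfl⟩;
    ∀ (r : LatticeRep G) (a : ℝ → ℝ), (∀ β, 0 < a β) → Tendsto a atTop (𝓝 0) →
      MomentBounds6 G r a → LowerBounds G r a → GapInUnits G r a →
      ∀ S : Set ℕ, UnboundedClass S → LatticeRotWardOn G r a S →
        ∃ (sch : SpeciesScheme (YMSpecies G)) (T : OSData (YMSpecies G) 4),
          sch.HasWeakCouplingLimit ∧ IsYangMillsFor r sch T ∧ T.IsNontrivial r.curvature ∧
            T.IsNonGaussian r.curvature ∧ ∃ Δ > 0, T.HasMassGap Δ ∧ HasLatticeMassGap r sch Δ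


/-! ## §3 The King input on a class (appended 2026-08-26, g2; candidate v5′ stub text for `ROT` rev 2′, owner's call)

With `BridgeOnClass` PROVED (`Theorems/BalabanLadderROTBridgeOnClass.lean`), the rotation leg may be owed on an unbounded torus class
only.  The King-side statement restricted to a class, and the candidate stub text leaving BOTH the class and the (irrational-over-`2π`)
angle to the deliverer (King's `(3,4,5)` pair on `5 ∣ 2L+1`, or a Bałaban-admissible odd block factor such as `13` with `(5,12,13)`);
closer `Theorems.ROT.rot2'_of_kingOnClass` (`Theorems/BalabanLadderROTOnClassKing.lean`).  Nothing asserted. -/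

section BinderKing

variable (G : Type) [Group G] [TopologicalSpace G] [IsTopologicalGroup G] [CompactSpace G]
  [MeasurableSpace G] [BorelSpace G] (r : LatticeRep G) (a : ℝ → ℝ)

/-- **`LatticeKingWardOn Θ S`** — King's finite-angle lattice Ward statement `Y2Bridge.LatticeKingWard G r a Θ` VERBATIM, restricted to
the admissible schemes in units `a` whose torus half-sides all lie in the class `S`. -/
def LatticeKingWardOn (Θ : Set ℝ) (S : Set ℕ) : Prop :=
  ∀ (sch : SpeciesScheme (YMSpecies G)), (∀ k, sch.L k ∈ S) → (∀ k, sch.a k = a (sch.β k)) →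
    Tendsto sch.β atTop atTop →
    (∀ k, 0 ≤ sch.β k ∧ sch.a k ≤ 1 / 24 ∧ 14 ≤ sch.L k ∧ (sch.a k)⁻¹ * (sch.a k)⁻¹ ≤ sch.L k) →
      ∃ r₀ : ℝ, 0 < r₀ ∧ ∀ (n : ℕ), 2 ≤ n → ∀ F ∈ King.KingClass n r₀, ∀ θ ∈ Θ,
        Tendsto (fun k =>
          latticeDist r.ρ (sch.β k) (sch.L k) (sch.a k) r.curvature.F
              (wilsonTorusMean r.ρ (sch.β k) (sch.L k) r.curvature.F) n (linActMulti (planeRot (0 : Fin 3) θ) F) -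
            latticeDist r.ρ (sch.β k) (sch.L k) (sch.a k) r.curvature.F
              (wilsonTorusMean r.ρ (sch.β k) (sch.L k) r.curvature.F) n F) atTop (𝓝 0)

end BinderKing

/-- **`KingOnClass`** (candidate v5′ stub text): for every compact simple `G`, every `r`, every positive unit map `a → 0` carrying
`MomentBounds6 G r a` and `GapInUnits G r a`, there are an UNBOUNDED torus class `S` and an angle `θ` with `θ / 2π` irrational such that
King's finite-angle lattice rotation defects at `θ` vanish along every admissible scheme with tori in `S` — ONE two-orientation
comparison on tori fitted by both lattices (C. King, CMP 103 (1986) Thm 2.4 for YM₄, unprinted; XXL).  consumes: `MomentBounds6` ↦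
compactness (`stub_uvExtract`) + density; `GapInUnits` ↦ volume-uniform locality for the comparison on the diverging tori of the class
(King II Thm 4.2 (4.9) `∝ |D_J|`; interpolated measures, caveat (i′)) + tilt insensitivity of the axis theory (straight torus
`ℝ⁴/Nℤ⁴` vs tilted torus `ℝ⁴/R(Nℤ⁴)`, King II (2.25); caveat (iii′), ym-beyond-p4 g17); the class removes only the torus-SIZE transfer
(non-fitted → fitted tori), not the tilt. -/
def KingOnClass : Prop :=
  ∀ (G : Type) [Group G] [TopologicalSpace G] [IsTopologicalGroup G] [CompactSpace G],
    IsCompactSimpleLieGroup G → letI : MeasurableSpace G := borel G; haveI : BorelSpace G := ⟨rfl⟩;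
    ∀ (r : LatticeRep G) (a : ℝ → ℝ), (∀ β, 0 < a β) → Tendsto a atTop (𝓝 0) → MomentBounds6 G r a →
      GapInUnits G r a →
      ∃ S : Set ℕ, UnboundedClass S ∧ ∃ θ : ℝ, Irrational (θ / (2 * Real.pi)) ∧
        LatticeKingWardOn G r a ({θ} : Set ℝ) S

/-! ## §4 Named copies of the two revisions of the route decl (appended 2026-08-26, g3; owner's R85 importer census, item 5b (b))

Owner's located ask of 2026-08-26T20:55:29Z (ym-beyond-p2 g21, `R85-BATCH-EDITS.md` rev 3e item 5b (b)): «land a NAMED copy of the rev-1 text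
(`ROTRev1 : Prop := <current BalabanLadder.ROT text>` + `rot2'_of_rotRev1`) so `rot_of_kingLimit`, `ROTSingleAngle`, `ROTKingHierarchy`, `ROTGuardIR`
producers and osasm-p2's bridges re-target in one line after the edit».  `ROTRev1` below is CHARACTER-IDENTICAL to the body of
`Summit.QuantumFields.YangMills.Theses.BalabanLadder.ROT` as filed today (rev 9 of the route; certificate `Theorems.ROT.rotRev1_iff_rot : ROTRev1 ↔ ROT`,
`Iff.rfl`, in `Theorems/BalabanLadderROTRevisions.lean` — to be dropped at the edit), and `ROTRev2'` is CHARACTER-IDENTICAL to the owner's pre-certified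
`YMBeyond.P2.R85Preview.ROT2'` (`p2-g20-files/R85_closes_preview.lean` a4c2b2513e9cd370; BC7 CLEAN 7c2a20a7eac68f1b) = the text of record for R85 item 3
(owner 20:37:54Z: «ROT rev 2′ OF RECORD, unconditional»).  This file has no `Theses` import, so both names survive the restate unchanged; the monotone link
`rotRev2'_of_rotRev1` and the re-targeted producers/closers live in `Theorems/BalabanLadderROTRevisions.lean`.  Nothing is asserted. -/

/-- **`ROTRev1`** — the rotation leg as filed in revisions 1–9 of the route (item stmt-QuantumFields-20042, decl `Theses.BalabanLadder.ROT`, verbatim):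
for every compact simple `G`, every `r`, every positive unit map `a → 0` with `LowerBounds G r a` and `MomentBounds6 G r a`, the lattice rotation-Ward
leg `LatticeRotWard G r a` (all admissible schemes).  Named so that its producers (`rot_of_kingLimit`, `rot_of_kingSingle`, `rot_of_kingAll`, …) and
consumers re-target by name when the decl is restated. -/
def ROTRev1 : Prop :=
  ∀ (G : Type) [Group G] [TopologicalSpace G] [IsTopologicalGroup G] [CompactSpace G],
    IsCompactSimpleLieGroup G → letI : MeasurableSpace G := borel G; haveI : BorelSpace G := ⟨rfl⟩;
    ∀ (r : LatticeRep G) (a : ℝ → ℝ), (∀ β, 0 < a β) → Filter.Tendsto a Filter.atTop (nhds 0) →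
      LowerBounds G r a → MomentBounds6 G r a → LatticeRotWard G r a

/-- **`ROTRev2'`** — the rotation leg of record for the R85 restate (owner's `ROT2'`, verbatim): the guards of rev 1, the infrared guard
`GapInUnits G r a`, and the Ward leg on SOME unbounded torus class (`∃ S, UnboundedClass S ∧ LatticeRotWardOn G r a S`) — the class the deliverer's
mechanism fits (King's `5 ∣ 2L+1`, …); consumed by the PROVED bridge re-run `Theorems.ROT.bridgeOnClass`.  `ROTRev1 → ROTRev2'`
(`Theorems.ROT.rotRev2'_of_rotRev1`). -/
def ROTRev2' : Prop :=
  ∀ (G : Type) [Group G] [TopologicalSpace G] [IsTopologicalGroup G] [CompactSpace G],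
    IsCompactSimpleLieGroup G → letI : MeasurableSpace G := borel G; haveI : BorelSpace G := ⟨rfl⟩;
    ∀ (r : LatticeRep G) (a : ℝ → ℝ), (∀ β, 0 < a β) → Tendsto a atTop (𝓝 0) →
      LowerBounds G r a → MomentBounds6 G r a → GapInUnits G r a →
        ∃ S : Set ℕ, UnboundedClass S ∧ LatticeRotWardOn G r a S

/-! ## §5 The infrared input of the tilt half of the split (appended 2026-08-27, g4; candidate hypothesis text, owner's call)

The recorded split `KingOnClass ⇐ NROT3 ∧ TI` (`Theorems/BalabanLadderROTTiltSplit.lean`) has its tilt half PROVED modulo ONE infrared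
input (`Theorems/BalabanLadderROTTiltBoundaryDecay.lean`, `tiltInsensitivityOn_of_boundaryDecay`; closers
`Theorems/BalabanLadderROTTiltBoundaryDecayClosers.lean`, `rotRev2'_of_nrot3_of_boundaryDecay : NROT3(S₅) → ‹§6 for all (G,r,a)› → ROTRev2'`):
exponential decay of the influence of the boundary condition on the lattice Yang–Mills cube kernels, at a rate `c₆ a(β)` per lattice unit
of depth (= rate `c₆` in PHYSICAL units), uniformly for `β ≥ β₆`, for bounded continuous cylinder observables, with the volume factor `b⁴`
(union bound) — Dobrushin–Shlosman-type weak mixing in units `a`, an input of MASS-GAP strength, NOT supplied by `GapInUnits` (two-point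
clustering on straight tori) and in print only at strong coupling (Osterwalder–Seiler 1978).  The text below is CHARACTER-IDENTICAL to the
binder `hdecay` of `tiltInsensitivityOn_of_boundaryDecay` (tree vocabulary `kerE` / `cubeEdges` / `depth` of
`Theorems/LangevinControlUVOSLegsFromFemtoAndGapDefs.lean`), so that the owner may guard `ROT` by it or file it as an item; nothing is asserted. -/

section BoundaryDecay

variable (G : Type) [Group G] [TopologicalSpace G] [IsTopologicalGroup G] [CompactSpace G]
  [MeasurableSpace G] [BorelSpace G] (r : LatticeRep G) (a : ℝ → ℝ)

/-- **`BoundaryDecayInUnits G r a` — exponential decay of boundary influence in units `a`** (candidate IR hypothesis text): there are a rate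
`c₆ > 0`, a threshold `β₆` and a constant `K₆` such that for `β ≥ β₆`, every cube `(c, b)` of `ℤ⁴`, every depth `d`, every two exteriors
`η, η'` and every bounded continuous cylinder observable `A` (`|A| ≤ M`) whose support edges have base points of depth `≥ d` in the cube,
`|kerE η A − kerE η' A| ≤ K₆ · M · b⁴ · exp(−c₆ · a(β) · d)`.  `BoundaryDecayInUnits G r a → TiltInsensitivityOn G r a t.tiltCell (fittedClass t.q)`
for every Pythagorean triple `t` (`Theorems.ROT.tiltInsensitivityOn_of_boundaryDecay`). [Georgii 2011 §8.2, Dobrushin–Shlosman weak mixing —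
the NOTION; for lattice YM₄ at weak coupling unproved (mass-gap strength); strong coupling: K. Osterwalder, E. Seiler, Ann. Phys. 110 (1978)] -/
def BoundaryDecayInUnits : Prop :=
  ∃ (c₆ β₆ K₆ : ℝ), 0 < c₆ ∧ ∀ β : ℝ, β₆ ≤ β →
    ∀ (c : Fin 4 → ℤ) (b d : ℕ) (η η' : LGConfig 4 G) (A : LGConfig 4 G → ℝ) (M : ℝ)
      (S : Finset (Literature.MathematicalPhysics.QuantumLattice.ZdEdge 4)),
      Continuous A → (∀ U, |A U| ≤ M) → IsCylinder A S → (∀ e ∈ S, d ≤ depth c b e.1) →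
      |kerE G r β c b η A - kerE G r β c b η' A| ≤ K₆ * M * (b : ℝ) ^ 4 * Real.exp (-(c₆ * a β * d))

end BoundaryDecay

/-- **`BoundaryDecayAll` — the infrared input posited for every compact simple `G`, every `r` and every unit map `a`** (candidate text;
the hypothesis `hBD` of `Theorems.ROT.ti_of_boundaryDecay` / `rotRev2'_of_nrot3_of_boundaryDecay` verbatim): with it, the typed open content
of `ROT` rev 2′ is `NROT3 king345.tiltCell (arcsin 3/5) (fittedClass 5)` alone.  Nothing is asserted. [same references] -/
def BoundaryDecayAll : Prop :=
  ∀ (G : Type) [Group G] [TopologicalSpace G] [IsTopologicalGroup G] [CompactSpace G],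
    IsCompactSimpleLieGroup G → letI : MeasurableSpace G := borel G; haveI : BorelSpace G := ⟨rfl⟩;
    ∀ (r : LatticeRep G) (a : ℝ → ℝ), BoundaryDecayInUnits G r a

/-! ## §6 ERRATUM to §5 and the repaired infrared input (appended 2026-08-27, g4)

§5's `BoundaryDecayInUnits` quantifies over ALL cubes `(c, b)`, including the EMPTY cube `b = 0`: there `depth c 0 ≡ 0`, so `d = 0` is admissible
for every support, the right-hand side `K₆·M·0⁴·e⁰ = 0` vanishes, while the kernel of the empty edge set is evaluation at the exterior — hence §5's
text forces every bounded continuous cylinder observable to be CONSTANT (kernel-checked: `Theorems.ROT.boundaryDecayInUnits_degenerate`,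
`Theorems/BalabanLadderROTTiltBoundaryDecayPos.lean`) and is unsatisfiable for a non-trivial gauge group; `BoundaryDecayAll` likewise, and the
theorems taking them (`tiltInsensitivityOn_of_boundaryDecay`, `ti_of_boundaryDecay`, `rotRev2'_of_nrot3_of_boundaryDecay`, …) are VACUOUS.
DO NOT USE §5.  The intended input carries the side condition `1 ≤ b` (non-degenerate cubes) and is typed below; the repaired chain is
`Theorems.ROT.tiltInsensitivityOn_of_boundaryDecayPos` / `ti_of_boundaryDecayPos` / `rotRev2'_of_nrot3_of_boundaryDecayPos` (same file), whose
hypotheses are CHARACTER-IDENTICAL to the bodies below.  Non-degeneracy of the repaired text: for `d ≤ 1` or small cubes the bound is the trivial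
regime `|Δ| ≤ 2M ≤ K₆ M b⁴ e^{−c₆ a(β)}` (choose `β₆` with `a ≤ 1` on `[β₆, ∞)`, `K₆ ≥ 2e^{c₆}`); for supports of depth `d ≥ 2` all support edges
are interior and the bound is genuine exponential decay of boundary influence in physical units (mass-gap strength; in print only at strong
coupling, Osterwalder–Seiler 1978).  Nothing is asserted. -/

section BoundaryDecayPos

variable (G : Type) [Group G] [TopologicalSpace G] [IsTopologicalGroup G] [CompactSpace G]
  [MeasurableSpace G] [BorelSpace G] (r : LatticeRep G) (a : ℝ → ℝ)

/-- **`BoundaryDecayInUnitsPos G r a` — exponential decay of boundary influence in units `a`, NON-DEGENERATE cubes** (candidate IR hypothesis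
text superseding §5's `BoundaryDecayInUnits`): there are `c₆ > 0`, `β₆`, `K₆` such that for `β ≥ β₆`, every cube `(c, b)` of `ℤ⁴` with `b ≥ 1`, every
depth `d`, every two exteriors `η, η'` and every bounded continuous cylinder observable `A` (`|A| ≤ M`) whose support edges have base points of
depth `≥ d` in the cube, `|kerE η A − kerE η' A| ≤ K₆ · M · b⁴ · exp(−c₆ · a(β) · d)`.
`BoundaryDecayInUnitsPos G r a → TiltInsensitivityOn G r a t.tiltCell (fittedClass t.q)` for every Pythagorean triple `t`
(`Theorems.ROT.tiltInsensitivityOn_of_boundaryDecayPos`, hypothesis character-identical). [Georgii 2011 §8.2 (the notion); K. Osterwalder,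
E. Seiler, Ann. Phys. 110 (1978) (strong coupling); unproved for lattice YM₄ at weak coupling] -/
def BoundaryDecayInUnitsPos : Prop :=
  ∃ (c₆ β₆ K₆ : ℝ), 0 < c₆ ∧ ∀ β : ℝ, β₆ ≤ β →
    ∀ (c : Fin 4 → ℤ) (b d : ℕ) (η η' : LGConfig 4 G) (A : LGConfig 4 G → ℝ) (M : ℝ)
      (S : Finset (Literature.MathematicalPhysics.QuantumLattice.ZdEdge 4)), 1 ≤ b →
      Continuous A → (∀ U, |A U| ≤ M) → IsCylinder A S → (∀ e ∈ S, d ≤ depth c b e.1) →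
      |kerE G r β c b η A - kerE G r β c b η' A| ≤ K₆ * M * (b : ℝ) ^ 4 * Real.exp (-(c₆ * a β * d))

end BoundaryDecayPos

/-- **`BoundaryDecayAllPos`** — the repaired infrared input posited for every compact simple `G`, every `r` and every unit map `a` (the
hypothesis `hBD` of `Theorems.ROT.ti_of_boundaryDecayPos` / `rotRev2'_of_nrot3_of_boundaryDecayPos`, character-identical); supersedes §5's
`BoundaryDecayAll`.  With it the typed open content of `ROT` rev 2′ is `NROT3 king345.tiltCell (arcsin 3/5) (fittedClass 5)` alone.  Nothing is
asserted. [same references] -/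
def BoundaryDecayAllPos : Prop :=
  ∀ (G : Type) [Group G] [TopologicalSpace G] [IsTopologicalGroup G] [CompactSpace G],
    IsCompactSimpleLieGroup G → letI : MeasurableSpace G := borel G; haveI : BorelSpace G := ⟨rfl⟩;
    ∀ (r : LatticeRep G) (a : ℝ → ℝ), BoundaryDecayInUnitsPos G r a

/-! ## §7 SECOND ERRATUM to §6 and the GUARDED infrared input (appended 2026-08-27, g5)

§6's `BoundaryDecayAllPos` posits `BoundaryDecayInUnitsPos G r a` for EVERY function `a : ℝ → ℝ` with no guard — not even `a → 0`.  The unit cube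
`b = 1` has no interior link but its site has depth `1`, so the `(b, d) = (1, 1)` instance reads `|f g₁ − f g₂| ≤ K₆ · M · exp (−c₆ · a(β))` for
every bounded continuous `f : G → ℝ` and `β ≥ β₆`: it forces `a` to be BOUNDED ABOVE on a tail — false for `a = id`.  Kernel-checked:
`Theorems.ROT.not_boundaryDecayAllPos : ¬ BoundaryDecayAllPos` (`Theorems/BalabanLadderROTBoundaryDecayGuard.lean`, instance `G = SU(2)`), so
`ti_of_boundaryDecayAllPos`, `kingOnClass_of_nrot3_of_boundaryDecayAllPos`, `rotRev2'_of_nrot3_of_boundaryDecayAllPos` and the `∀ a` inline closers of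
`…TiltBoundaryDecayPos.lean` are VACUOUS.  DO NOT USE `BoundaryDecayAllPos` (nor register it as a stub text).  The per-`(G, r, a)` text
`BoundaryDecayInUnitsPos G r a` of §6 is NOT affected: for a genuine unit map `a → 0` the corner is the trivial regime
(`Theorems.ROT.corner_of_tendsto_zero`, `K₆ = 2 e^{c₆}` on a tail where `a ≤ 1`).

The tilt half consumes the input only at the `(G, r, a)` at which `TI` is asked, i.e. behind the guard block shared by `TI` / `NROT3` /
`KingOnClass` (`∀ β, 0 < a β`, `a → 0`, `MomentBounds6 G r a`, `GapInUnits G r a`).  The text below is §6's per-`(G, r, a)` input placed behind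
EXACTLY that guard block; it is CHARACTER-IDENTICAL to the hypothesis `hBD` of `Theorems.ROT.ti_of_boundaryDecayGuarded` /
`kingOnClass_of_nrot3_of_boundaryDecayGuarded` / `rotRev2'_of_nrot3_of_boundaryDecayGuarded` (same file), which therefore become its closers by
name (`NROT3(S₅) → BoundaryDecayGuarded → ROTRev2'`).  Content for deep supports on large cubes: exponential weak mixing of the lattice Yang–Mills
cube kernels in PHYSICAL units at the unit maps of the legs — mass-gap strength, the same strength as `GapInUnits` (which does not formally supply
it), open at weak coupling, in print only at strong coupling.  Nothing is asserted. -/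

/-- **`BoundaryDecayGuarded`** — the boundary-decay input BEHIND THE GUARDS of the tilt half (supersedes §6's unsatisfiable `BoundaryDecayAllPos`):
for every compact simple `G`, every `r` and every positive unit map `a → 0` carrying `MomentBounds6 G r a` and `GapInUnits G r a`, the cube kernels
satisfy `BoundaryDecayInUnitsPos G r a` (§6: for `β ≥ β₆`, cubes `b ≥ 1`, bounded continuous cylinder observables supported at depth `≥ d`,
`|kerE η A − kerE η' A| ≤ K₆ · M · b⁴ · exp (−c₆ · a(β) · d)`).  `BoundaryDecayGuarded → TI t.tiltCell (fittedClass t.q)` for every Pythagorean triple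
(`Theorems.ROT.ti_of_boundaryDecayGuarded`, hypothesis character-identical).  Nothing is asserted. [Georgii 2011 §8.2 (weak mixing — the notion);
K. Osterwalder, E. Seiler, Ann. Phys. 110 (1978) (strong coupling); unproved for lattice YM₄ at weak coupling] -/
def BoundaryDecayGuarded : Prop :=
  ∀ (G : Type) [Group G] [TopologicalSpace G] [IsTopologicalGroup G] [CompactSpace G],
    IsCompactSimpleLieGroup G → letI : MeasurableSpace G := borel G; haveI : BorelSpace G := ⟨rfl⟩;
    ∀ (r : LatticeRep G) (a : ℝ → ℝ), (∀ β, 0 < a β) → Tendsto a atTop (𝓝 0) → MomentBounds6 G r a →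
      GapInUnits G r a → BoundaryDecayInUnitsPos G r a

end Summit.QuantumFields.YangMills.Theorems.ROT

end
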